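import Summits.ResolutionOfSingularities.ResolutionOfSingularities.Theorems.PurelyInseparableDim4ResConeShadeTwoBranching
import Summits.ResolutionOfSingularities.ResolutionOfSingularities.Theorems.PurelyInseparableDim4TschirnhausChain
import Summits.ResolutionOfSingularities.ResolutionOfSingularities.Theorems.PurelyInseparableDim4TschirnhausCleanVertex
import Summits.ResolutionOfSingularities.ResolutionOfSingularities.Theorems.PurelyInseparableDim4ResConeLevelTwoTriple
import HarnessLib
import HarnessLib.Audit.Tags

/-!
# Purely inseparable four-folds — K2(p), PHASE `d = 2`, PART X: first-order Tschirnhaus frames on the residual quadric and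
# the MATCHING LEMMA (every prime `p ≠ 2`)

[OURS · counted 0 · cell `res-dim4-pi` · seat res-dim4-p-7 g3 · K2(p) lane (holder res-dim4-p-12 lineage; desk WORDs #82 (c),
#96 (a)); frame infrastructure res-dim4-p-11 g3 (`…TschirnhausClean/Chain/Cone`) and res-dim4-p-1 g3 (`…TschirnhausIsolation`,
`…TschirnhausCleanVertex`).]  Nothing here proves K2(p), `NoIsolatedTrap p p`, or resolution of singularities in dimension ≥ 4 /
characteristic `p`.  AI kernel work, weaker than expert review.

The located `d = 2` residue (`…ShadeTwoResidue.shadeTwo_located`) is a walk whose translations are FORCED by the residual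
quadric `g` (`…ShadeTwoBranching.forced_translation`: at a shade-keeping step in the chart `x_j` translating only the free
letter `f`, `g_{jf} + 2 b_f g_{ff} = 0`).  A Tschirnhaus frame `x_f ↦ x_f + φ(u)` turns such a translated step into a CORNER
step exactly when the linear coefficient of `φ` along `x_j` is `b_f`.  This file supplies the algebra:
* `coeff_mixed_tsch_linear` / `coeff_sq_tsch_linear`: for the linear move `ℓ = Σ cᵢ xᵢ` (`c_f = 0`) and ANY polynomial `g`,
  `coeff_{x_j x_f} (tsch f ℓ g) = g_{jf} + 2 c_j g_{ff}` and `coeff_{x_f²} (tsch f ℓ g) = g_{ff}` (via p-11's polar chain rule);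
* `exists_firstOrderFrame`: with `g_{ff} ≠ 0` the linear move `c_i = −g_{if} / (2 g_{ff})` kills every `x_i x_f` (`i ≠ f`);
* `eval_zero_chartTransform_one`: the translation produced by pushing a datum `ψ` (`ψ(0) = 0`) through the `x_j`-chart is its
  linear `x_j`-coefficient, `ψ′(0) = coeff_{x_j} ψ`;
* **`frame_translation_eq`** (THE MATCHING LEMMA): if the clean re-framed state `T_ψ s = ⟨clean (tsch f ψ s.F), r, exc⟩` has NO
  monomial `x^r x_j x_f`, and the honest step `(j, b)` at `s` keeps the shade with `b` supported on `f`, then `ψ′(0) = b_f` —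
  so the frame's corner step in the chart `x_j` sits over the honest translated step (p-11's `step_cleanTsch` with `b⁺ = b`).
bears_on: LADDER-RESOLUTION:D157-DOOR2 (res-dim4-pi · K2(p) · phase d = 2).  Supports stmt-ResolutionOfSingularities-16155
(helper).
-/

set_option linter.dupNamespace false -- mandated namespace of this single-conjunct summit

noncomputable section

namespace Summit.ResolutionOfSingularities.ResolutionOfSingularities.Theorems.PIDim4

namespace ResCone

open MvPolynomial Finset
open Literature.AlgebraicGeometry.Resolution
open Literature.AlgebraicGeometry.Resolution.CentreBlowup
open Literature.AlgebraicGeometry.Resolution.Hauser2010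
open Literature.AlgebraicGeometry.Resolution.HauserPerlega2019
open FrameChange
open PointBlowup (polarMap)

variable {K : Type} [Field K]

/-! ## §1 Linear moves on coefficients of degree ≤ 2 -/

section Linear

variable {f : Fin 4} {c : Fin 4 → K}

/-- The linear move acts on linear forms: `coeff_{x_f} (tsch f ℓ L) = coeff_{x_f} L` for `ℓ = Σ cᵢ xᵢ` with `c_f = 0` and ANY
`L` (only the degree-`1` part of `L` matters, and there `x_f ↦ x_f + ℓ`, `x_i ↦ x_i`). [folklore] -/
theorem coeff_single_tsch_linear (hc : c f = 0) (L : MvPolynomial (Fin 4) K) :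
    coeff (Finsupp.single f 1) (tsch f (∑ i, C (c i) * X i) L) = coeff (Finsupp.single f 1) L := by
  classical
  have h1 : ∀ P : MvPolynomial (Fin 4) K, coeff (Finsupp.single f 1) P =
      coeff (Finsupp.single f 1) (homogeneousComponent 1 P) := fun P => by
    rw [coeff_homogeneousComponent, if_pos (Finsupp.degree_single f 1)]
  rw [h1 (tsch f _ L), homogeneousComponent_tsch (isHomogeneous_linear c), homogeneousComponent_one_eq_linearForm L, map_sum,
    coeff_sum, Finset.sum_eq_single f]
  · rw [map_mul, MvPolynomial.algHom_C, MvPolynomial.algebraMap_eq, coeff_C_mul, tsch_X_self, coeff_add, coeff_X, if_pos rfl, coeff_single_linearForm, hc,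
      add_zero, mul_one]
  · intro i _ hif
    rw [map_mul, MvPolynomial.algHom_C, MvPolynomial.algebraMap_eq, coeff_C_mul, tsch_X_of_ne _ hif, coeff_X,
      if_neg (fun h => hif (Finsupp.single_left_injective one_ne_zero h)), mul_zero]
  · exact fun h => absurd (Finset.mem_univ f) h

/-- **`coeff_{x_j x_f} (tsch f ℓ g) = g_{jf} + 2 c_j g_{ff}`** for the linear move `ℓ = Σ cᵢ xᵢ` (`c_f = 0`), `j ≠ f`, and ANY
polynomial `g`: the `x_f`-coefficient of the polar `∂_{e_j} (tsch ℓ g) = tsch ℓ (∂_{e_j + c_j e_f} g)` (p-11's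
`polarMap_tsch_linear`). [folklore] -/
theorem coeff_mixed_tsch_linear (hc : c f = 0) {j : Fin 4} (hjf : j ≠ f) (g : MvPolynomial (Fin 4) K) :
    coeff (Finsupp.single j 1 + Finsupp.single f 1) (tsch f (∑ i, C (c i) * X i) g) =
      coeff (Finsupp.single j 1 + Finsupp.single f 1) g + 2 * c j * coeff (Finsupp.single f 2) g := by
  classical
  -- `x_f`-coefficient of the polar in the direction `e_j`
  have hL : coeff (Finsupp.single f 1) (polarMap (tsch f (∑ i, C (c i) * X i) g) (Pi.single j 1)) =
      coeff (Finsupp.single j 1 + Finsupp.single f 1) (tsch f (∑ i, C (c i) * X i) g) := by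
    rw [NarrowApolarity.coeff_polarMap, Finset.sum_eq_single j]
    · rw [Pi.single_eq_same, one_mul, Finsupp.single_apply, if_neg hjf.symm, Nat.cast_zero, zero_add, mul_one,
        add_comm]
    · intro i _ hij
      rw [Pi.single_eq_of_ne hij, zero_mul]
    · exact fun h => absurd (Finset.mem_univ j) h
  rw [← hL, polarMap_tsch_linear hc, coeff_single_tsch_linear hc, NarrowApolarity.coeff_polarMap,
    Finset.sum_eq_add_of_mem j f (Finset.mem_univ j) (Finset.mem_univ f) hjf]
  · rw [Function.update_of_ne hjf, Function.update_self, Pi.single_eq_same, Pi.single_eq_of_ne hjf.symm, zero_add,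
      Finset.sum_eq_single j, Pi.single_eq_same, mul_one]
    · rw [Finsupp.single_apply, if_neg hjf.symm, Finsupp.single_eq_same, add_comm (Finsupp.single f 1),
        ← Finsupp.single_add, one_add_one_eq_two]
      push_cast
      ring
    · intro i _ hij
      rw [Pi.single_eq_of_ne hij, mul_zero]
    · exact fun h => absurd (Finset.mem_univ j) h
  · intro i _ ⟨hij, hif⟩
    rw [Function.update_of_ne hif, Pi.single_eq_of_ne hij, zero_mul]

/-- **`coeff_{x_f²} (tsch f ℓ g) = g_{ff}`** (`c_f = 0`, `2 ≠ 0` in `K`, any `g`). [folklore] -/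
theorem coeff_sq_tsch_linear (hc : c f = 0) (h2 : (2 : K) ≠ 0) (g : MvPolynomial (Fin 4) K) :
    coeff (Finsupp.single f 2) (tsch f (∑ i, C (c i) * X i) g) = coeff (Finsupp.single f 2) g := by
  classical
  have hL : ∀ P : MvPolynomial (Fin 4) K,
      coeff (Finsupp.single f 1) (polarMap P (Pi.single f 1)) = 2 * coeff (Finsupp.single f 2) P := by
    intro P
    rw [NarrowApolarity.coeff_polarMap, Finset.sum_eq_single f]
    · rw [Pi.single_eq_same, one_mul, Finsupp.single_eq_same, ← Finsupp.single_add, one_add_one_eq_two]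
      push_cast
      ring
    · intro i _ hif
      rw [Pi.single_eq_of_ne hif, zero_mul]
    · exact fun h => absurd (Finset.mem_univ f) h
  have h := hL (tsch f (∑ i, C (c i) * X i) g)
  rw [polarMap_tsch_linear hc, coeff_single_tsch_linear hc] at h
  have hw : Function.update (Pi.single f 1 : Fin 4 → K) f ((Pi.single f 1 : Fin 4 → K) f + ∑ i, c i * (Pi.single f 1 : Fin 4 → K) i) =
      Pi.single f 1 := by
    rw [Finset.sum_eq_single f (fun i _ hif => by rw [Pi.single_eq_of_ne hif, mul_zero])
      (fun h => absurd (Finset.mem_univ f) h), hc, zero_mul, add_zero, Function.update_eq_self]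
  rw [hw, hL] at h
  exact (mul_right_injective₀ h2 h).symm

/-- **THE FIRST-ORDER FRAME**: if `g_{ff} ≠ 0` and `2 ≠ 0` in `K`, the linear move `c_i = −g_{if} / (2 g_{ff})` (`i ≠ f`),
`c_f = 0`, kills every mixed monomial `x_i x_f` of `g` and keeps `g_{ff}`. [cite: Abhyankar1990, Lecture 25 pp. 216–217] [folklore] -/
theorem exists_firstOrderFrame (f : Fin 4) (g : MvPolynomial (Fin 4) K) (hg : coeff (Finsupp.single f 2) g ≠ 0)
    (h2 : (2 : K) ≠ 0) :
    ∃ c : Fin 4 → K, c f = 0 ∧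
      (∀ i, i ≠ f → coeff (Finsupp.single i 1 + Finsupp.single f 1) (tsch f (∑ i, C (c i) * X i) g) = 0) ∧
      coeff (Finsupp.single f 2) (tsch f (∑ i, C (c i) * X i) g) = coeff (Finsupp.single f 2) g := by
  classical
  set c : Fin 4 → K := fun i => if i = f then 0 else
      -(coeff (Finsupp.single i 1 + Finsupp.single f 1) g) / (2 * coeff (Finsupp.single f 2) g) with hc
  have hcf : c f = 0 := by rw [hc]; exact if_pos rfl
  refine ⟨c, hcf, fun i hi => ?_, coeff_sq_tsch_linear hcf h2 g⟩
  rw [coeff_mixed_tsch_linear hcf hi]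
  have hci : c i = -(coeff (Finsupp.single i 1 + Finsupp.single f 1) g) / (2 * coeff (Finsupp.single f 2) g) := by
    rw [hc]; exact if_neg hi
  rw [hci]
  field_simp
  ring

end Linear

/-! ## §2 The translation a frame datum produces in a chart -/

/-- **`ψ′(0) = coeff_{x_j} ψ`**: for `ψ(0) = 0`, the value at the origin of the small transform `chartTransform 1 univ j ψ`
is the `x_j`-coefficient of `ψ` (the only monomials landing on the constant are `x_j` and `1`). [folklore] -/
theorem eval_zero_chartTransform_one (j : Fin 4) {ψ : MvPolynomial (Fin 4) K} (h0 : constantCoeff ψ = 0) :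
    MvPolynomial.eval (0 : Fin 4 → K) (chartTransform 1 Finset.univ j ψ) = coeff (Finsupp.single j 1) ψ := by
  classical
  rw [MvPolynomial.eval_zero]
  unfold chartTransform
  rw [map_sum]
  simp_rw [constantCoeff_monomial]
  have hiff : ∀ d ∈ ψ.support, (chartExponent 1 Finset.univ j d = 0 ↔ Finsupp.single j 1 = d) := by
    intro d hd
    constructor
    · intro h
      have hoff : ∀ i, i ≠ j → d i = 0 := fun i hij => by
        have := congrArg (fun e : Fin 4 →₀ ℕ => e i) h
        simp only [Finsupp.coe_zero, Pi.zero_apply] at this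
        rwa [chartExponent_apply_of_ne 1 Finset.univ hij] at this
      have hdeg : d.degree ≤ 1 := by
        have := congrArg (fun e : Fin 4 →₀ ℕ => e j) h
        simp only [chartExponent_univ_apply_self, Finsupp.coe_zero, Pi.zero_apply] at this
        omega
      have hd0 : d ≠ 0 := by
        rintro rfl
        exact (MvPolynomial.mem_support_iff.mp hd) h0
      rw [eq_single_of_forall d hoff]
      congr 1
      have h1 := congrArg Finsupp.degree (eq_single_of_forall d hoff)
      rw [Finsupp.degree_single] at h1
      have : d.degree ≠ 0 := fun h => hd0 ((Finsupp.degree_eq_zero_iff d).mp h)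
      omega
    · rintro rfl
      ext i
      by_cases hij : i = j
      · rw [hij, chartExponent_univ_apply_self, Finsupp.degree_single]; rfl
      · rw [chartExponent_apply_of_ne 1 Finset.univ hij, Finsupp.single_apply, if_neg (Ne.symm hij)]; rfl
  rw [Finset.sum_congr rfl fun d hd => if_congr (hiff d hd) rfl rfl, Finset.sum_ite_eq]
  split_ifs with h
  · rfl
  · exact (MvPolynomial.notMem_support_iff.mp h).symm

/-! ## §3 Exponents of degree ≤ 1; the step reads only `F` and `r` -/

/-- An exponent of degree `≤ 1` is `0` or some `e_i`. [folklore] -/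
theorem eq_zero_or_eq_single_of_degree_le_one {m : Fin 4 →₀ ℕ} (h : m.degree ≤ 1) :
    m = 0 ∨ ∃ i, m = Finsupp.single i 1 := by
  by_cases hm : m = 0
  · exact Or.inl hm
  · right
    obtain ⟨i₀, hi₀⟩ : ∃ i, m i ≠ 0 := by
      by_contra h'
      push Not at h'
      exact hm (Finsupp.ext h')
    have h0 : m.degree ≠ 0 := fun h0 => hm ((Finsupp.degree_eq_zero_iff m).mp h0)
    exact ⟨i₀, eq_single_of_degree_eq_one (by omega) hi₀⟩

/-- The multiplicities of a step do not read the boundary components. [folklore] -/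
theorem step_r_eq_of_F_eq_of_r_eq [DecidableEq K] (q : ℕ) (S : Finset (Fin 4)) (j : Fin 4) (b : Fin 4 → K) {s t : State K}
    (hF : s.F = t.F) (hr : s.r = t.r) : (CentreBlowup.step q S j b s).r = (CentreBlowup.step q S j b t).r := by
  change newMult q S j b s = newMult q S j b t
  unfold newMult
  rw [hF, hr]

section CleanStep

variable [DecidableEq K] (p : ℕ) [hp : Fact p.Prime] [CharP K p] {f j : Fin 4} {φ : MvPolynomial (Fin 4) K}

/-- p-11's `step_F_cleanTsch` for ANY presented state `ŝ` with `ŝ.F = clean (tsch f φ s.F)` (boundary components free):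
`(step p univ j b ŝ).F = clean (tsch f φ⁺ (step p univ j b⁺ s).F)`. [cite: Hauser2010, §§F–G] [folklore] -/
theorem step_F_of_cleanTsch {ŝ s : State K} (hF : ŝ.F = deletePthPowers p (tsch f φ s.F))
    (hq : (p : ℕ∞) ≤ ordZero s.F) (hjf : j ≠ f) (h0 : constantCoeff φ = 0) (b : Fin 4 → K) :
    (CentreBlowup.step p Finset.univ j b ŝ).F =
      deletePthPowers p (tsch f (PointBlowup.translate b (chartTransform 1 Finset.univ j φ) -
          C (MvPolynomial.eval b (chartTransform 1 Finset.univ j φ)))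
        (CentreBlowup.step p Finset.univ j
          (Function.update b f (b f + MvPolynomial.eval b (chartTransform 1 Finset.univ j φ))) s).F) := by
  rw [BandShade.step_F_congr (q := p) (S := Finset.univ) (j := j) (b := b) (s := ŝ)
    (t := (⟨deletePthPowers p (tsch f φ s.F), s.r, s.exc⟩ : State K)) hF]
  exact step_F_cleanTsch p hq hjf h0 b

/-- p-11's `step_r_cleanTsch` for ANY presented state `ŝ` with `ŝ.F = clean (tsch f φ s.F)`, `ŝ.r = s.r` (`s.F` clean,
`f` free, `φ` admissible): `(step p univ j b ŝ).r = (step p univ j b⁺ s).r`. [cite: Hauser2010, §F] [folklore] -/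
theorem step_r_of_cleanTsch {ŝ s : State K} (hF : ŝ.F = deletePthPowers p (tsch f φ s.F)) (hrr : ŝ.r = s.r)
    (hs : deletePthPowers p s.F = s.F) (hφ : f ∉ φ.vars) (h0 : constantCoeff φ = 0) (hr : s.r f = 0) (j : Fin 4)
    (b : Fin 4 → K) :
    (CentreBlowup.step p Finset.univ j b ŝ).r =
      (CentreBlowup.step p Finset.univ j
        (Function.update b f (b f + MvPolynomial.eval b (chartTransform 1 Finset.univ j φ))) s).r := by
  rw [step_r_eq_of_F_eq_of_r_eq p Finset.univ j b (s := ŝ)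
    (t := (⟨deletePthPowers p (tsch f φ s.F), s.r, s.exc⟩ : State K)) hF hrr]
  exact step_r_cleanTsch p hs hφ h0 hr j b

end CleanStep

/-! ## §4 The matching lemma -/

section Matching

variable [DecidableEq K] (p : ℕ)

/-- **THE MATCHING LEMMA.**  Let `s` be a presented shade-`2` band state (`x^r ∣ F`, `ord₀ F = W + 2`, `p ≤ W + 1`,
`W + 4 ≤ 2p`, `p ∤ W + 2`) with a free letter `f` (`r_f = 0`) whose square sits in the quadric (`g_{ff} ≠ 0`), and let the
honest step `(j, b)` (`j ≠ f`, `b_j = 0`, `b` supported on `f`) keep the shade.  If an admissible datum `ψ` (`ψ(0) = 0`,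
`f ∉ vars ψ`) re-frames `s` to a clean state WITHOUT the monomial `x^r x_j x_f`, then the translation the frame produces in
the chart `x_j` IS the honest one: `ψ′(0) = b_f`.  (First-order straightness `⇒` `g_{jf} + 2 ψ_j g_{ff} = 0`; the forced
translation `⇒` `g_{jf} + 2 b_f g_{ff} = 0`; `2 g_{ff} ≠ 0`.) [OURS · K2(p) phase d = 2] [folklore] -/
theorem frame_translation_eq {s : State K} {W : ℕ} (hW : s.r.degree = W) (ho : ordZero s.F = ((W + 2 : ℕ) : ℕ∞))
    (hr : ∀ e ∈ s.F.support, s.r ≤ e) (hpW : p ≤ W + 1) (hW2 : W + 4 ≤ 2 * p) (hpo : ¬ p ∣ W + 2)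
    {f : Fin 4} (hrf : s.r f = 0) (hsq : coeff (Finsupp.single f 2) (resForm s) ≠ 0) (h2 : (2 : K) ≠ 0)
    {j : Fin 4} (hjf : j ≠ f) {b : Fin 4 → K} (hbj : b j = 0) (hb : ∀ i, i ≠ f → b i = 0)
    (heq : (CentreBlowup.step p Finset.univ j b s).shade = s.shade)
    {ψ : MvPolynomial (Fin 4) K} (h0 : constantCoeff ψ = 0) (hψ : f ∉ ψ.vars)
    (hstr : coeff (s.r + (Finsupp.single j 1 + Finsupp.single f 1)) (deletePthPowers p (tsch f ψ s.F)) = 0) :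
    MvPolynomial.eval (0 : Fin 4 → K) (chartTransform 1 Finset.univ j ψ) = b f := by
  classical
  -- the cone of the clean re-framed state is the linear part's move of the cone
  obtain ⟨c, hcf, hlin⟩ := exists_homogeneousComponent_one_eq_linear hψ
  have hcj : c j = coeff (Finsupp.single j 1) ψ := by
    rw [← coeff_single_linearForm c j, ← hlin, coeff_homogeneousComponent, if_pos (Finsupp.degree_single j 1)]
  have hres : resForm (⟨deletePthPowers p (tsch f ψ s.F), s.r, s.exc⟩ : State K) =
      tsch f (∑ i, C (c i) * X i) (resForm s) := by
    rw [resForm_cleanTschState_eq p hψ h0 ho hpo, resForm_tschState_eq_tsch_linearPart hψ h0 hrf hr, hlin]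
  -- first-order straightness read on the cone
  have hoT : ordZero (deletePthPowers p (tsch f ψ s.F)) = ((W + 2 : ℕ) : ℕ∞) :=
    ordZero_deletePthPowers_of_not_dvd p ((ordZero_tsch hψ h0 s.F).trans ho) hpo
  have hzero : coeff (Finsupp.single j 1 + Finsupp.single f 1) (tsch f (∑ i, C (c i) * X i) (resForm s)) = 0 := by
    rw [← hres, coeff_resForm_eq_coeff_add (s := ⟨deletePthPowers p (tsch f ψ s.F), s.r, s.exc⟩) hoT
      (by rw [map_add, Finsupp.degree_single, Finsupp.degree_single]; change 1 + 1 = W + 2 - s.r.degree; omega)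
      (by change s.r.degree ≤ W + 2; omega)]
    exact hstr
  rw [coeff_mixed_tsch_linear hcf hjf] at hzero
  -- the forced translation
  have hforced := forced_translation (p := p) hbj ho hr hpW hW2 heq hjf.symm hb
  rw [eval_zero_chartTransform_one j h0, ← hcj]
  have h : 2 * coeff (Finsupp.single f 2) (resForm s) * (c j - b f) = 0 := by linear_combination hzero - hforced
  rcases mul_eq_zero.mp h with h' | h'
  · exact absurd h' (mul_ne_zero h2 hsq)
  · exact sub_eq_zero.mp h'

end Matching

end ResCone

end Summit.ResolutionOfSingularities.ResolutionOfSingularities.Theorems.PIDim4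

end
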